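import Summits.BirchSwinnertonDyer.BirchSwinnertonDyer.Theorems.CountingDoorF2AtThreeSchneiderOnDoorSubfamilyStubHeightDigits
import Summits.BirchSwinnertonDyer.BirchSwinnertonDyer.Theorems.CountingDoorF2AtThreeSchneiderOnDoorSubfamilyStubTransport
import Summits.BirchSwinnertonDyer.BirchSwinnertonDyer.Theorems.CountingDoorF2AtThreeDigitCertificateKernel
import HarnessLib

/-!
# BirchSwinnertonDyer / CountingDoorF2AtThree — crux I4loc `SchneiderOnDoorSubfamily`
# (stmt-BirchSwinnertonDyer-19682) PROVED: the line `valuation-class-at-three` (v3) assembled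

Closing file of the crux I4loc of `route-BirchSwinnertonDyer-CountingDoorF2AtThree` (cell bsd-rank2; v3
line author / STUB 1 owner cd-valclass-digits assembling the REGISTERED skeleton
`Cruxes/SchneiderOnDoorSubfamily/Lines/valuation_class_at_three.lean`, sha16 ad82ec43829a909f, whose two
stubs have LANDED: STUB 1 `stub_heightDigits` — p462093, this seat; STUB 3 `stub_transport` — p462254,
cd-transport; STUB 2/4 of v2 are eng-2's digit-certificate kernel p452361 and cd-density-one's p452042).
PARTITION: none — r_an ≥ 2, summit axis S0; TWIN (D-0056): n/a. B1 honesty: `3`-adic height ALGEBRA on the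
explicit congruence family `Φ = F₂ ∩ {a ≡ (7,0,4,0) mod 9} ∩ {(1,0,1,0) mod 25} ∩ {(1,2,4,3) mod 7} ∩
{ℓ² ∤ Δ}` — non-degeneracy of every canonical `3`-adic height datum on every globally minimal good-ordinary
model of rank two of EVERY member, by the first-digit certificate `(1, 2)` of `ĥ₃(2P₁)/3, ĥ₃(3P₂)/3`;
nothing reads an analytic rank; no S0 motion (the crux feeds the TWIN leaf `PAdicBSDRankTwoPositiveProportion`).

* `schneiderOnDoorSubfamily` — THE CRUX, by the v3 composition `SchneiderOnDoorSubfamily_of` run on the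
  landed stubs (unconditional: no sigma-existence fact; the junk branch of the tree's `padicSigma` is empty
  on the family by `PAdicHeightData.not_isCanonical_of_not_exists_pair`, p459247, and on the minimal models
  by cd-transport's `a₁_ne_zero_or_a₃_ne_zero_smul_curve` + lit's `CanonicalPAdicHeightJunkSigmaProofs`).
* Consequently the route's counting bridge (eng-2's `countingBridgeLoc : CountingBridgeLoc`, p450499) needs
  only the fact pack, the large-family inputs, generic members, I1 and I2: I4loc is no longer an open input
  (`countingBridgeLoc hIn hLF hG h1 h2 schneiderOnDoorSubfamily : PAdicBSDRankTwoPositiveProportion`).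

Seats whose theorems this composition runs on: eng-2 (kernel, T1–T3 data fixing the multipliers `(2,3)` and
the class), cd-valclass-denom (S2, division values, class congruences, cross term), cd-valclass-sigma3 (S3,
second-order sigma evaluation, `3`-adic digit kernel), bsd-rank2-lit (Ayad's lemma, junk-sigma file),
cd-bridge-loc (S1 sieve-class family), cd-density-one (STUB 4), cd-transport (STUB 3), this seat (v3, STUB 1).
References: Mazur–Stein–Tate 2006 §1 [MazurSteinTate2006]; Bhargava–Ho 2022 §1 [BhargavaHo2022];
Schneider 1982 [Schneider1982PadicHeightI].
-/

set_option linter.dupNamespace false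

noncomputable section

open scoped Classical
open WeierstrassCurve Literature.NumberTheory.EllipticCurves
  Literature.NumberTheory.EllipticCurves.BhargavaHo2022
  Summit.BirchSwinnertonDyer.BirchSwinnertonDyer.Theses.CountingDoorF2AtThree

namespace Summit.BirchSwinnertonDyer.BirchSwinnertonDyer.Theorems

/-- **Crux I4loc `SchneiderOnDoorSubfamily` (stmt-BirchSwinnertonDyer-19682).** There is a large
congruence subfamily `Φ` of Bhargava–Ho's `F₂` with a nonempty condition at every prime whose members all
satisfy the local door conditions of `leaf_of_local` (ρ̄₃ irreducible; every globally minimal model ordinary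
at `3` with a Skinner–Urban auxiliary prime) and in which, for a density-one set of members (in fact for
EVERY member), Schneider non-degeneracy at `3` holds for every canonical `3`-adic height datum on every
globally minimal good-ordinary model of Mordell–Weil rank `2`. Proof = the registered v3 skeleton of the
line `valuation-class-at-three` on its landed stubs: `stub_heightDigits` (digit certificate `(1,2)` for
`2P₁, 3P₂` on `Φ = F₂ ∩ {a ≡ (7,0,4,0) mod 9} ∩ {(1,0,1,0) mod 25} ∩ {(1,2,4,3) mod 7} ∩ {ℓ² ∤ Δ}`),
`stub_transport` (model change), the digit-certificate kernel and the density step.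
[cite: MazurSteinTate2006, §1 eq. (1.1) and Thm. 1.3] [cite: Schneider1982PadicHeightI, §1 (non-degeneracy conjecture)]
[cite: BhargavaHo2022, §1 (large subfamilies defined by congruence conditions)] -/
theorem schneiderOnDoorSubfamily : SchneiderOnDoorSubfamily := by
  obtain ⟨Φ, hL, hne, hmem, hloc, hsq, hdig⟩ :=
    CountingDoorF2AtThreeSchneiderOnDoorSubfamilyStubHeightDigits.stub_heightDigits
  refine schneiderOnDoorSubfamily_of_memberwise Φ hL hne hloc hmem ?_
  intro a ha
  refine CountingDoorF2AtThreeSchneiderOnDoorSubfamilyStubTransport.stub_transport a ha.1 (hsq a ha) ?_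
  intro Dh hDh hrank
  haveI : a.curve.IsElliptic := Params.isElliptic_curve ha.1
  obtain ⟨dA, dB, h2, hA, hB, hC⟩ := hdig a ha Dh hDh
  exact schneiderConjecture_of_nonresidue_digits Dh _ _ 2 3 hA hB hC h2 hrank

end Summit.BirchSwinnertonDyer.BirchSwinnertonDyer.Theorems

end
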